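import Summits.QuantumFields.BalabanUV.InfraRed.StrongCouplingFrozenForestClustering
import Summits.QuantumFields.BalabanUV.InfraRed.StrongCouplingWeightedKREngine
import HarnessLib

/-!
# Strong-coupling front, gen-14 engine (W3): covariance decay under the FROZEN Wilson measure with WEIGHTED forest rows —
observatory of the non-perturbative crossover; no mass-gap claim

IR-3 v2 TWO-FRONT CROSSOVER LEDGER, front SC (`β₀`).
ABSOLUTE RULE of this package: No internally-minted statement may enter as a cited fact. Every hypothesis is either
kernel-proved in this package or a verbatim quotation of a PUBLISHED theorem with page reference. The manuscript(s)
under audit are NOT citable for their own disputed steps — they are the thing under adjudication; programme-internal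
(2001/route/tribunal) claims are never citable.  Nothing is cited as a hypothesis here.

## What this file is

(W3) of the weighted forest door: `WeightedForestRowBound F v ρ` — every dynamic link `e ∉ F` has
`∑_{y ∉ F} n(e,y) v y ≤ ρ v e` — and `abs_integral_mul_sub_le_frozenWilson_weighted`, verbatim the tree's
`StrongCouplingFrozenForestClustering.abs_integral_mul_sub_le_frozenWilson` with the weighted covariance estimate
`StrongCouplingWeightedKREngine.abs_covariance_le_of_isKRContraction_weighted` as its input and the Dobrushin constant
`ρ (|β|/N) K ≤ c ≤ 1` in place of `D (|β|/N) K ≤ c`.  With `v ≡ 1`, `ρ = D` it is the tree's lemma.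

NOT CLAIMED: any number of the ledger (the weight table of the staggered forests, (W4), is not in this file); no
mass-gap claim.
-/

noncomputable section

open MeasureTheory ProbabilityTheory Filter Function Finset
open Literature.Probability.LatticeModels
open Literature.Probability.LatticeModels.DobrushinMetric
open Literature.MathematicalPhysics.QuantumFieldTheory
open Literature.MathematicalPhysics.QuantumLattice (fundamentalRep fundamentalLatticeRep)
open Literature.MathematicalPhysics.QuantumFieldTheory.Balaban1983to89
open Literature.MathematicalPhysics.QuantumFieldTheory.Balaban1983to89.StrongCouplingDobrushinWindow
open Literature.MathematicalPhysics.QuantumFieldTheory.Balaban1983to89.StrongCouplingTorusWindow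
open Summit.QuantumFields.BalabanUV.InfraRed.StrongCouplingForestGauge
open Summit.QuantumFields.BalabanUV.InfraRed.StrongCouplingForestGaugeFixing
open Summit.QuantumFields.BalabanUV.InfraRed.StrongCouplingFrozenForestSpec
open Summit.QuantumFields.BalabanUV.InfraRed.StrongCouplingFrozenForestKR
open Summit.QuantumFields.BalabanUV.InfraRed.StrongCouplingWeightedKREngine

namespace Summit.QuantumFields.BalabanUV.InfraRed.StrongCouplingWeightedFrozenCovariance

section SUN

variable {d L N : ℕ} [NeZero L]

/-- **Weighted forest row bound**: for a weight `v` on links and a constant `ρ`, every dynamic link `e ∉ F` has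
`∑_{y ∈ linkNbrT e, y ∉ F} n(e,y) · v y ≤ ρ · v e` (`n = tInfluence`).  A parametric definition of a proposition —
nothing asserted; `v ≡ 1`, `ρ = D` is `ForestRowBound F D`. [folklore] -/
def WeightedForestRowBound (F : Finset (Edge d L)) (v : Edge d L → ℝ) (ρ : ℝ) : Prop :=
  ∀ e : Edge d L, e ∉ F → (∑ y ∈ linkNbrT e, if y ∈ F then (0 : ℝ) else (tInfluence e y : ℝ) * v y) ≤ ρ * v e

/-- A plain row bound is a weighted one with unit weights. [folklore] -/
theorem weightedForestRowBound_one_of_forestRowBound (F : Finset (Edge d L)) {D : ℕ} (hD : ForestRowBound F D) :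
    WeightedForestRowBound F (fun _ => 1) D := by
  intro e he
  have h := hD e he
  have hcast : ((forestRow F e : ℕ) : ℝ) ≤ D := by exact_mod_cast h
  simpa [forestRow, Nat.cast_sum, Nat.cast_ite] using hcast

/-- **The weighted Dobrushin rows of the frozen coefficients**: under `WeightedForestRowBound F v ρ` with `v ≥ 0`,
`ρ ≥ 0`, `∑_y C(e,y) v y ≤ (ρ (|β|/N) K) v e` for the frozen KR coefficients
`C(e,y) = [e ∉ F][y ∉ F] K (|β|/N) n(e,y)`. [folklore] -/
theorem sum_linkNbrT_frozenCoeff_mul_le (F : Finset (Edge d L)) {v : Edge d L → ℝ} {ρ : ℝ}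
    (hρ : WeightedForestRowBound F v ρ) (hv0 : ∀ y, 0 ≤ v y) (hρ0 : 0 ≤ ρ) {β K : ℝ} (hK : 0 ≤ K) (e : Edge d L) :
    (∑ y ∈ linkNbrT e, (if e ∈ F ∨ y ∈ F then (0 : ℝ) else K * (|β| / N) * (tInfluence e y : ℝ)) * v y) ≤
      ρ * (|β| / N) * K * v e := by
  by_cases he : e ∈ F
  · have h0 : (∑ y ∈ linkNbrT e, (if e ∈ F ∨ y ∈ F then (0 : ℝ) else K * (|β| / N) * (tInfluence e y : ℝ)) * v y)
        = 0 := Finset.sum_eq_zero fun y _ => by simp [he]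
    rw [h0]
    exact mul_nonneg (by positivity) (hv0 e)
  · have h1 : (∑ y ∈ linkNbrT e, (if e ∈ F ∨ y ∈ F then (0 : ℝ) else K * (|β| / N) * (tInfluence e y : ℝ)) * v y)
        = K * (|β| / N) * ∑ y ∈ linkNbrT e, (if y ∈ F then (0 : ℝ) else (tInfluence e y : ℝ) * v y) := by
      rw [Finset.mul_sum]
      refine Finset.sum_congr rfl fun y _ => ?_
      by_cases hy : y ∈ F
      · simp [hy]
      · simp only [he, hy, or_self, if_false]
        ring
    rw [h1]
    calc K * (|β| / N) * ∑ y ∈ linkNbrT e, (if y ∈ F then (0 : ℝ) else (tInfluence e y : ℝ) * v y)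
        ≤ K * (|β| / N) * (ρ * v e) := mul_le_mul_of_nonneg_left (hρ e he) (by positivity)
      _ = ρ * (|β| / N) * K * v e := by ring

/-- **Covariance bound under the frozen Wilson measure, WEIGHTED rows** (twin of
`abs_integral_mul_sub_le_frozenWilson`; Föllmer 1988 Ch. I Thm. (2.13) with Remark (2.17) on the frozen specification,
weighted sup-norm): under `WeightedForestRowBound F v ρ`, `vmin ≤ v`, `0 < vmin`, the one-link modulus and
`ρ (|β|/N) K ≤ c ≤ 1`, the connected correlation of bounded measurable local `f, g` with plaquette-separated supports
is at most `2 (2√N)² (∑_{plaqClosure Δ_g} M_g L_β) ∑_{y ∈ plaqClosure Δ_f} (v y / vmin) c^{ℓ y} (M_f L_β)`.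
[cite: Follmer1988, Ch. I Theorem (2.13)] [cite: Georgii2011, Thm. 8.7, Thm. 8.20, Remark 8.26, §8.2] -/
theorem abs_integral_mul_sub_le_frozenWilson_weighted (hd : 2 ≤ d) (hN : 1 ≤ N) (hL : 1 < L)
    (F : Finset (Edge d L)) {v : Edge d L → ℝ} {ρ vmin : ℝ} (hFv : WeightedForestRowBound F v ρ) (hρ0 : 0 ≤ ρ)
    (hvmin : 0 < vmin) (hv : ∀ y, vmin ≤ v y) {β R K c : ℝ} (hK : 0 ≤ K)
    (hR : |β| / N * (2 * ((d : ℝ) - 1)) ≤ R) (hmod : OneLinkKRModulus N R K)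
    (hc : ρ * (|β| / N) * K ≤ c) (hc1 : c ≤ 1)
    {f g : GaugeConfig d L (Matrix.specialUnitaryGroup (Fin N) ℂ) → ℝ} (hfm : Measurable f)
    {Δf : Finset (Edge d L)} (hfdep : DependsOn f (↑Δf : Set (Edge d L))) {Mf : ℝ} (hMf : ∀ σ, |f σ| ≤ Mf)
    (hgm : Measurable g) {Δg : Finset (Edge d L)} (hgdep : DependsOn g (↑Δg : Set (Edge d L))) {Mg : ℝ}
    (hMg : ∀ σ, |g σ| ≤ Mg) (hsep : ∀ y ∈ plaqClosure Δf, y ∉ Δg) (ℓ : Edge d L → ℕ)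
    (hℓ0 : ∀ y ∈ plaqClosure Δg, ℓ y = 0) (hℓ : ∀ x ∉ plaqClosure Δg, ∀ y ∈ linkNbrT x, ℓ x ≤ ℓ y + 1) :
    |(∫ σ, f σ * g σ ∂(frozenWilsonMeasure (d := d) (L := L) (fundamentalRep (Fin N)) F β)) -
        (∫ σ, f σ ∂(frozenWilsonMeasure (d := d) (L := L) (fundamentalRep (Fin N)) F β)) *
          ∫ σ, g σ ∂(frozenWilsonMeasure (d := d) (L := L) (fundamentalRep (Fin N)) F β)| ≤
      2 * (2 * Real.sqrt N) ^ 2 * (∑ _y ∈ plaqClosure Δg, Mg * wilsonSmoothLip N d β) *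
        ∑ y ∈ plaqClosure Δf, v y / vmin * c ^ ℓ y * (Mf * wilsonSmoothLip N d β) := by
  classical
  set μ := frozenWilsonMeasure (d := d) (L := L) (fundamentalRep (Fin N)) F β with hμdef
  have hv' := continuous_wilsonPlaqWeight (N := N) β
  have hv0' := wilsonPlaqWeight_pos (N := N) β
  have hγ := isSpecification_frozenSpec (d := d) (L := L) F hv' hv0'
  have hG : IsGibbsMeasure (frozenSpec (d := d) (L := L) F (wilsonPlaqWeight N β)) μ :=
    isGibbsMeasure_frozenWilsonMeasure F β
  haveI : IsProbabilityMeasure μ := hG.isProbabilityMeasure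
  have hd1 : 1 ≤ d := by omega
  have hN0 : (0 : ℝ) < N := by exact_mod_cast (show 0 < N by omega)
  have hKR := isKRContraction_frozenWilson (L := L) hd1 hN hL F hK hR hmod
  have hc0 : 0 ≤ c := le_trans (by positivity) hc
  have hvnn : ∀ y, 0 ≤ v y := fun y => hvmin.le.trans (hv y)
  have hrow : ∀ e : Edge d L, (∑ y ∈ linkNbrT e,
      (if e ∈ F ∨ y ∈ F then (0 : ℝ) else K * (|β| / N) * (tInfluence e y : ℝ)) * v y) ≤ c * v e := fun e =>
    (sum_linkNbrT_frozenCoeff_mul_le F hFv hvnn hρ0 hK e).trans (mul_le_mul_of_nonneg_right hc (hvnn e))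
  set fb := specAvg (frozenSpec (d := d) (L := L) F (wilsonPlaqWeight N β)) Δf f with hfb
  set gb := specAvg (frozenSpec (d := d) (L := L) F (wilsonPlaqWeight N β)) Δg g with hgb
  have hfbm : Measurable fb := measurable_specAvg hγ Δf hfm
  have hgbm : Measurable gb := measurable_specAvg hγ Δg hgm
  have hfbM : ∀ σ, |fb σ| ≤ Mf := abs_specAvg_le hγ Δf hMf
  have hgbM : ∀ σ, |gb σ| ≤ Mg := abs_specAvg_le hγ Δg hMg
  have hfbdep : DependsOn fb (↑(plaqClosure Δf) : Set (Edge d L)) :=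
    dependsOn_specAvg_frozenSpec F hv' Δf hfm hfdep
  have hgbdep : DependsOn gb (↑(plaqClosure Δg) : Set (Edge d L)) :=
    dependsOn_specAvg_frozenSpec F hv' Δg hgm hgdep
  have hvLip : ∀ (q : Plaquette d L) (y : Edge d L), y ∈ plaqEdgesT q →
      ∀ U U' : GaugeConfig d L (Matrix.specialUnitaryGroup (Fin N) ℂ), (∀ z, z ≠ y → U z = U' z) →
      |Real.log (wilsonPlaqWeight N β (plaquetteHolonomy U q.1 q.2.1.1 q.2.1.2)) -
          Real.log (wilsonPlaqWeight N β (plaquetteHolonomy U' q.1 q.2.1.1 q.2.1.2))| ≤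
        |β| * Real.sqrt N * suFrobDist (U y) (U' y) :=
    fun q y hy U U' hUU' => abs_log_wilsonPlaqWeight_hol_sub_le hL β q hy hUU'
  have hD : (0 : ℝ) < 2 * Real.sqrt N := by positivity
  have hfbLip : IsLipBound suFrobDist fb fun _ => Mf * wilsonSmoothLip N d β :=
    isLipBound_specAvg_frozenSpec F hv' hv0' suFrobDist_nonneg hD suFrobDist_le (by positivity) hvLip Δf hfm
      hfdep hMf
  have hgbLip : IsLipBound suFrobDist gb fun _ => Mg * wilsonSmoothLip N d β :=
    isLipBound_specAvg_frozenSpec F hv' hv0' suFrobDist_nonneg hD suFrobDist_le (by positivity) hvLip Δg hgm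
      hgdep hMg
  have h1 : ∫ σ, f σ * g σ ∂μ = ∫ σ, fb σ * gb σ ∂μ := by
    have ha : ∫ η, fb η * g η ∂μ = ∫ σ, f σ * g σ ∂μ :=
      integral_specAvg_mul hγ hG Δf hfm hMf hgm hMg hgdep fun x hx => hsep x (subset_plaqClosure Δf hx)
    have hb : ∫ η, gb η * fb η ∂μ = ∫ σ, g σ * fb σ ∂μ :=
      integral_specAvg_mul hγ hG Δg hgm hMg hfbm hfbM hfbdep fun x hx hx' => hsep x hx' hx
    rw [← ha]
    have hb' : ∫ η, fb η * gb η ∂μ = ∫ σ, fb σ * g σ ∂μ := by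
      simp_rw [mul_comm (fb _)]
      exact hb
    exact hb'.symm
  have h2 : ∫ σ, f σ ∂μ = ∫ σ, fb σ ∂μ := (integral_specAvg hγ hG Δf hfm hMf).symm
  have h3 : ∫ σ, g σ ∂μ = ∫ σ, gb σ ∂μ := (integral_specAvg hγ hG Δg hgm hMg).symm
  rw [h1, h2, h3]
  have key := abs_covariance_le_of_isKRContraction_weighted hγ hKR (r := suFrobDist) (R := 2 * Real.sqrt N)
    suFrobDist_nonneg suFrobDist_le hD.le hc0 hc1 hvmin hv hrow hG hfbm hfbdep hfbM hfbLip hgbm hgbdep hgbM hgbLip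
    ℓ hℓ0 hℓ
  have hcov : cov[fb, gb; μ] = (∫ σ, fb σ * gb σ ∂μ) - (∫ σ, fb σ ∂μ) * ∫ σ, gb σ ∂μ := by
    rw [covariance_eq_sub]
    · rfl
    · exact memLp_of_bounded (a := -Mf) (b := Mf) (ae_of_all _ fun σ => abs_le.1 (hfbM σ))
        hfbm.aestronglyMeasurable 2
    · exact memLp_of_bounded (a := -Mg) (b := Mg) (ae_of_all _ fun σ => abs_le.1 (hgbM σ))
        hgbm.aestronglyMeasurable 2
  rw [hcov] at key
  exact key

end SUN

end Summit.QuantumFields.BalabanUV.InfraRed.StrongCouplingWeightedFrozenCovariance
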